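import Summits.QuantumFields.YangMills.Theorems.SwapVirialDeficitSectorLaplaceMbDensityFloorDetRescaled
import Summits.QuantumFields.YangMills.Theorems.SwapVirialDeficitSectorLaplaceMbDensityComparable
import HarnessLib

/-!
# Route `SwapVirialDeficit` (YangMills): THE TWO-POINT PROFILE COMPARABILITY OF THE MORSE–BOTT DENSITY — tip hub `hubAt δ_t 1` at base point `p` against shell hub
# `hubAt δ_s 1` at a NEARBY base point `p′`, for EVERY `p` (corner, mid-range, gnomonic ends) and EVERY `δ_t ≥ δ_r` (no upper cut):
# `𝔪(hubAt δ_t 1, ε, p) ≤ R₀·(1+δ_t²)²∕(1 + h(p)(1+δ_t²))·(w₀(p)∕w₀(p′))·𝔪(hubAt δ_s 1, ε, p′)`, `h(p) = x₀²∕(1+x₀²) + y₀²∕(1+y₀²)`, `w₀(p) = (1+x₀²)⁻¹(1+y₀²)⁻¹`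
# (cell ym-idea-1, skeleton ➎, `stub_core_tip`: the single pointwise socket of g49's ONE-STROKE (δ_t, p)-integration layer (STATUS 00:50Z) — the structured floor kept
# WHOLE, `det M′ ≥ sin²θ cos²θ (sin²θ + h(p))∕(1800L⁶)²`: the `α_uα_v ∝ sin⁴θ` term regularises the corner `p → 0`, the `c_r` term the apex `θ → 0`;
# free-hands support of ⟨stmt-QuantumFields-24197⟩ `SwapVirialDeficit.SwapGluedStiffness`)

* `floorDetRescaled_ge_profile` — `cos²θ·sin²θ·(sin²θ + h(p))∕(1800L⁶)² ≤ det M′(θ,p)` for ALL `p` (the rescaled structured-floor determinant of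
  ✓`mbDensity_angUnit_le_floorDet_rescaled`).
* ★★★ `mbDensity_hubAt_comparable_profile` — good `ε`, `1 ≤ δ_r ≤ δ_s, δ_t`, joint matching window
  `(122689728·δ_r⁻¹ + 44712000·‖gnoBase p − gnoBase p′‖)·L⁴ ≤ μ_F∕(2·3|Fol L|)` ⟹ the display above with
  `R₀ = e·((1+d)·20400L⁴)^{7∕2}·(√(¼(1800L⁶)⁻¹)³)⁻¹·(2·(1800L⁶)²)`; ingredients: the rescaled tip ceiling (w2 g61), the rescaled ISOTROPIC shell floor
  ✓`mbDensity_ge_detFol_rescaled'` (w2 g60) at `p′`, and the JOINT (hub angle + base point) one-loop matching ✓`abs_log_det_gnoFolHessian_sub_le_joint` with the base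
  coercivity ✓`gnoFolHessian_coercive_base`.  The δ_t-column `∫_{δ_t>δ_τ}((1+δ_t²)⁻¹)²·profile dδ_t = ∫ dδ_t∕(1 + h(p)(1+δ_t²)) ≤ min(√(2τ)∕h(p), π∕(2√h(p)))`
  and the `p′`-average over the corner disc are the integration layer's (g49).

HONEST LABEL: algebra on landed bricks; the (δ_t,p)-integration, the `I ↔ 𝔪` two-sided law on the mid window, the core `δ_t > δ_b`, and the assembly of `stub_core_tip`,
⟨24197⟩ ∕ ⟨24194⟩ remain OPEN; own crux ⟨22884⟩ `LargeFieldMassRefinementTail` OPEN (blocked-on ⟨19935⟩); the Yang–Mills mass gap is NOT proved; no summit is proved by a line.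
THEOREMS ONLY (0 `def`, 0 `sorry`, no instance), standard axioms.  Width seat ym-line-sfw-p2-w2 g61 (cell ym-idea-1, free hands), `--supports stmt-QuantumFields-24197`.
References: [cite: Luscher1983, §2]; [cite: Breitung1994, Lemma 26]; [folklore].
-/

set_option autoImplicit false
set_option synthInstance.maxSize 1024

noncomputable section

open MeasureTheory Quaternion Set Module
open scoped Quaternion BigOperators ENNReal InnerProductSpace
open Literature.MathematicalPhysics.QuantumLattice
open Literature.MathematicalPhysics.QuantumFieldTheory hiding SU2

namespace Summit.QuantumFields.YangMills.Theorems.SwapVirialDeficit.SectorLaplace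

open Summit.QuantumFields.YangMills.Theorems.FemtoTransferGap
open Summit.QuantumFields.YangMills.Theorems.FemtoTransferGap.TT
open Summit.QuantumFields.YangMills.Theorems.VirialFluxGap.RingDeficit
open Summit.QuantumFields.YangMills.Theorems.SwapVirialDeficit.SwapRing
open Summit.QuantumFields.YangMills.Theorems.SwapVirialDeficit.BlowUpRing

variable {L : ℕ} [NeZero L]

/-- ★ **THE RESCALED STRUCTURED-FLOOR DETERMINANT KEPT WHOLE**: `cos²θ·sin²θ·(sin²θ + h(p))∕(1800L⁶)² ≤ det M′(θ,p)` for every base point `p`,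
`h(p) = x₀²∕(1+x₀²) + y₀²∕(1+y₀²)`. [folklore] -/
theorem floorDetRescaled_ge_profile (θ : ℝ) (p : ℝ × ℝ) :
    Real.cos θ ^ 2 * Real.sin θ ^ 2 * (Real.sin θ ^ 2 + (p.1 ^ 2 / (1 + p.1 ^ 2) + p.2 ^ 2 / (1 + p.2 ^ 2))) / (1800 * (L : ℝ) ^ 6) ^ 2 ≤
      ((1 / 4 : ℝ) * (16 * Real.cos θ ^ 2 * Real.sin θ ^ 2 / ((7200 * (L : ℝ) ^ 6) * (1 + p.1 ^ 2))) * Real.sqrt (1 + p.1 ^ 2) ^ 2) *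
          ((1 / 4 : ℝ) * (4 * Real.sin θ ^ 2 / ((1800 * (L : ℝ) ^ 6) * (1 + p.2 ^ 2))) * Real.sqrt (1 + p.2 ^ 2) ^ 2) +
        ((1 / 4 : ℝ) * (4 / ((1800 * (L : ℝ) ^ 6) * ((1 + p.1 ^ 2) * (1 + p.2 ^ 2))))) *
          (((1 / 4 : ℝ) * (16 * Real.cos θ ^ 2 * Real.sin θ ^ 2 / ((7200 * (L : ℝ) ^ 6) * (1 + p.1 ^ 2))) * Real.sqrt (1 + p.1 ^ 2) ^ 2) *
              (p.1 * Real.sqrt (1 + p.2 ^ 2)) ^ 2 +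
            ((1 / 4 : ℝ) * (4 * Real.sin θ ^ 2 / ((1800 * (L : ℝ) ^ 6) * (1 + p.2 ^ 2))) * Real.sqrt (1 + p.2 ^ 2) ^ 2) *
              (Real.sqrt (1 + p.1 ^ 2) * p.2) ^ 2) := by
  have hL : (0 : ℝ) < (L : ℝ) := Nat.cast_pos.2 (Nat.pos_of_ne_zero (NeZero.ne L))
  have hX1 : Real.sqrt (1 + p.1 ^ 2) ^ 2 = 1 + p.1 ^ 2 := Real.sq_sqrt (by positivity)
  have hY1 : Real.sqrt (1 + p.2 ^ 2) ^ 2 = 1 + p.2 ^ 2 := Real.sq_sqrt (by positivity)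
  have hp1 : (p.1 * Real.sqrt (1 + p.2 ^ 2)) ^ 2 = p.1 ^ 2 * (1 + p.2 ^ 2) := by rw [mul_pow, hY1]
  have hp2 : (Real.sqrt (1 + p.1 ^ 2) * p.2) ^ 2 = (1 + p.1 ^ 2) * p.2 ^ 2 := by rw [mul_pow, hX1]
  rw [hp1, hp2, hX1, hY1]
  set c2 : ℝ := Real.cos θ ^ 2 with hc2
  set s2 : ℝ := Real.sin θ ^ 2 with hs2
  set X : ℝ := 1 + p.1 ^ 2 with hX
  set Y : ℝ := 1 + p.2 ^ 2 with hY
  set K : ℝ := 1800 * (L : ℝ) ^ 6 with hK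
  have hc0 : 0 ≤ c2 := sq_nonneg _
  have hs0 : 0 ≤ s2 := sq_nonneg _
  have hc1 : c2 ≤ 1 := by rw [hc2]; nlinarith [Real.cos_sq_add_sin_sq θ, sq_nonneg (Real.sin θ)]
  have hX0 : 0 < X := by rw [hX]; positivity
  have hY0 : 0 < Y := by rw [hY]; positivity
  have hK0 : 0 < K := by rw [hK]; positivity
  -- normal form: `det M′ = s2/K²·(c2 s2 + c2 x₀²/X + y₀²/Y)`
  have e : ((1 / 4 : ℝ) * (16 * c2 * s2 / ((7200 * (L : ℝ) ^ 6) * X)) * X) * ((1 / 4 : ℝ) * (4 * s2 / (K * Y)) * Y) +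
      ((1 / 4 : ℝ) * (4 / (K * (X * Y)))) * (((1 / 4 : ℝ) * (16 * c2 * s2 / ((7200 * (L : ℝ) ^ 6) * X)) * X) * (p.1 ^ 2 * Y) +
        ((1 / 4 : ℝ) * (4 * s2 / (K * Y)) * Y) * (X * p.2 ^ 2)) =
      s2 / K ^ 2 * (c2 * s2 + c2 * p.1 ^ 2 / X + p.2 ^ 2 / Y) := by
    rw [hK]; field_simp; ring
  rw [e]
  have h1 : c2 * (s2 + (p.1 ^ 2 / X + p.2 ^ 2 / Y)) ≤ c2 * s2 + c2 * p.1 ^ 2 / X + p.2 ^ 2 / Y := by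
    have ha : c2 * (p.2 ^ 2 / Y) ≤ p.2 ^ 2 / Y := by
      calc c2 * (p.2 ^ 2 / Y) ≤ 1 * (p.2 ^ 2 / Y) := by gcongr
        _ = p.2 ^ 2 / Y := one_mul _
    have hsplit : c2 * (s2 + (p.1 ^ 2 / X + p.2 ^ 2 / Y)) = c2 * s2 + c2 * p.1 ^ 2 / X + c2 * (p.2 ^ 2 / Y) := by ring
    rw [hsplit]
    linarith
  calc c2 * s2 * (s2 + (p.1 ^ 2 / X + p.2 ^ 2 / Y)) / K ^ 2 = s2 / K ^ 2 * (c2 * (s2 + (p.1 ^ 2 / X + p.2 ^ 2 / Y))) := by ring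
    _ ≤ s2 / K ^ 2 * (c2 * s2 + c2 * p.1 ^ 2 / X + p.2 ^ 2 / Y) := mul_le_mul_of_nonneg_left h1 (by positivity)

set_option maxHeartbeats 1600000 in
/-- ★★★ **THE TWO-POINT PROFILE COMPARABILITY** (g49's one-stroke layer, pointwise socket).  Good signs, `1 ≤ δ_r ≤ δ_s, δ_t`, base points `p, p′` in the JOINT matching
window `(122689728·δ_r⁻¹ + 44712000·‖gnoBase p − gnoBase p′‖)·L⁴ ≤ μ_F∕(2·3|Fol L|)`.  Then, with `h(p) = x₀²∕(1+x₀²) + y₀²∕(1+y₀²)`,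
`𝔪(hubAt δ_t 1, ε, p) ≤ R₀·((1+δ_t²)²∕(1 + h(p)(1+δ_t²)))·((1+x₀′²)(1+y₀′²)∕((1+x₀²)(1+y₀²)))·𝔪(hubAt δ_s 1, ε, p′)`,
`R₀ = e·((1+d)·20400L⁴)^{7∕2}·(√(¼(1800L⁶)⁻¹)³)⁻¹·(2·(1800L⁶)²)`. [cite: Luscher1983, §2] [cite: Breitung1994, Lemma 26] -/
theorem mbDensity_hubAt_comparable_profile {ε : GnoSign L} (hε : GoodSign ε) {δr δs δt : ℝ} (hδr : 1 ≤ δr) (hrs : δr ≤ δs) (hrt : δr ≤ δt)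
    (p p' : ℝ × ℝ)
    (hwin : (122689728 * δr⁻¹ + 44712000 * ‖(gnoBase p.1 p.2 : GnoCoord L) - gnoBase p'.1 p'.2‖) * (L : ℝ) ^ 4 ≤
      (2304 * (L : ℝ) ^ 6 * (Fintype.card (Fol L) : ℝ))⁻¹ / (2 * (3 * (Fintype.card (Fol L) : ℝ)))) :
    mbDensity (L := L) (hubAt δt 1) ε p ≤
      (Real.exp 1 * ((1 + (finrank ℝ (GnoFol L) : ℝ)) * (20400 * (L : ℝ) ^ 4)) ^ (7 / 2 : ℝ) *
          (Real.sqrt ((1 / 4 : ℝ) * (1 / (1800 * (L : ℝ) ^ 6))) ^ 3)⁻¹ * (2 * (1800 * (L : ℝ) ^ 6) ^ 2)) *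
        ((1 + δt ^ 2) ^ 2 / (1 + (p.1 ^ 2 / (1 + p.1 ^ 2) + p.2 ^ 2 / (1 + p.2 ^ 2)) * (1 + δt ^ 2))) *
        ((1 + p'.1 ^ 2) * (1 + p'.2 ^ 2) / ((1 + p.1 ^ 2) * (1 + p.2 ^ 2))) * mbDensity (L := L) (hubAt δs 1) ε p' := by
  have hL : (0 : ℝ) < (L : ℝ) := Nat.cast_pos.2 (Nat.pos_of_ne_zero (NeZero.ne L))
  have hδr0 : 0 < δr := by linarith
  have hδs0 : 0 < δs := by linarith
  have hδt0 : 0 < δt := by linarith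
  have hδt1 : 1 ≤ δt := hδr.trans hrt
  set μ : ℝ := (2304 * (L : ℝ) ^ 6 * (Fintype.card (Fol L) : ℝ))⁻¹ with hμ
  have hμ0 : 0 < μ := (folMu_pos_le (L := L)).1
  set N : ℝ := (Fintype.card (Fol L) : ℝ) with hN
  have hN3 : (3 : ℝ) ≤ N := by
    have h := nine_le_finrank_gnoFol (L := L)
    rw [finrank_gnoFol_real] at h
    linarith
  set H : ℝ := p.1 ^ 2 / (1 + p.1 ^ 2) + p.2 ^ 2 / (1 + p.2 ^ 2) with hH
  have hH0 : 0 ≤ H := by rw [hH]; positivity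
  -- dimensions (opaque)
  have hd9 := nine_le_finrank_gnoFol (L := L)
  obtain ⟨d, hd⟩ : ∃ d : ℝ, (finrank ℝ (GnoFol L) : ℝ) = d := ⟨_, rfl⟩
  rw [hd] at hd9 ⊢
  have hdpos : 0 < d := by linarith
  -- the hub angles `θ(δ) = π/2 − arctan δ`
  obtain ⟨hst2, hct2⟩ := sin_sq_cos_sq_hubAngle δt
  have hsint : 0 < Real.sin (Real.pi / 2 - Real.arctan δt) := sin_hubAngle_pos δt
  have hsins : 0 < Real.sin (Real.pi / 2 - Real.arctan δs) := sin_hubAngle_pos δs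
  have hcost : Real.cos (Real.pi / 2 - Real.arctan δt) ≠ 0 := by
    intro h
    have : Real.cos (Real.pi / 2 - Real.arctan δt) ^ 2 = 0 := by rw [h]; ring
    rw [hct2] at this
    exact absurd this (by positivity)
  -- the two follower families (at the hubs `hubAt δt 1`, `hubAt δs 1`)
  obtain ⟨At, hAts, -, hAtyy, hAtray, hAtamb, -, -⟩ := exists_gnoFolHessian (fun _ => false) (fun _ => (1 : SU2)) (hubAt_one_ne_zero δt) ε
  obtain ⟨As, hAss, -, hAsyy, hAsray, hAsamb, -, -⟩ := exists_gnoFolHessian (fun _ => false) (fun _ => (1 : SU2)) (hubAt_one_ne_zero δs) ε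
  set η₀ : GnoCoord L := gnoBase p.1 p.2 with hη₀
  set η₀' : GnoCoord L := gnoBase p'.1 p'.2 with hη₀'
  set Dt : ℝ := Real.sqrt (LinearMap.det (At η₀)) with hDt
  set Ds : ℝ := Real.sqrt (LinearMap.det (As η₀')) with hDs
  have hdett : μ ^ finrank ℝ (GnoFol L) ≤ LinearMap.det (At η₀) := det_gnoFolHessian_base_ge (hubAt_one_ne_zero δt) ε hε.1 hε.2 p.1 p.2 hAts hAtray
  have hdets : μ ^ finrank ℝ (GnoFol L) ≤ LinearMap.det (As η₀') := det_gnoFolHessian_base_ge (hubAt_one_ne_zero δs) ε hε.1 hε.2 p'.1 p'.2 hAss hAsray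
  have hdett0 : 0 < LinearMap.det (At η₀) := lt_of_lt_of_le (by positivity) hdett
  have hdets0 : 0 < LinearMap.det (As η₀') := lt_of_lt_of_le (by positivity) hdets
  have hDt0 : 0 < Dt := Real.sqrt_pos.2 hdett0
  have hDs0 : 0 < Ds := Real.sqrt_pos.2 hdets0
  -- §T the rescaled tip ceiling at `hubAt δt 1 ~ angUnit θt`, base point `p`
  have hAtyy' : ∀ η (y : GnoFol L), ⟪At η y, y⟫_ℝ =
      iteratedFDeriv ℝ 2 (fun y' : GnoFol L => gnoDeficit (fun _ => false) (fun _ => 1) (angUnit (Real.pi / 2 - Real.arctan δt)) ε (η + gnoFolEmb y')) 0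
        (fun _ => y) := by
    intro η y
    rw [hAtyy η y]
    simp_rw [gnoDeficit_hubAt_eq_angUnit (fun _ => false) (fun _ => (1 : SU2)) δt ε]
  have hT := mbDensity_angUnit_le_floorDet_rescaled hcost hsint.ne' hε p hAts hAtyy'
  rw [mbDensity_angUnit_hubAngle] at hT
  -- §S the rescaled isotropic shell floor at `hubAt δs 1`, base point `p′`
  have hres : (hubAt δs 1).re ≠ 0 := by rw [hubAt_one_re]; exact hδs0.ne'
  have hS := mbDensity_ge_detFol_rescaled' hres (hubAt_one_im_ne_zero δs) hε p' hAss hAsyy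
  rw [hd] at hS
  -- §M the JOINT one-loop matching (hub angle and base point)
  have eθt : gnoDeficit (fun _ => false) (fun _ => (1 : SU2)) (hubAt δt 1) ε =
      gnoDeficit (fun _ => false) (fun _ => 1) (angUnit (Real.pi / 2 - Real.arctan δt)) ε :=
    funext fun η => gnoDeficit_hubAt_eq_angUnit _ _ δt ε η
  have eθs : gnoDeficit (fun _ => false) (fun _ => (1 : SU2)) (hubAt δs 1) ε =
      gnoDeficit (fun _ => false) (fun _ => 1) (angUnit (Real.pi / 2 - Real.arctan δs)) ε :=
    funext fun η => gnoDeficit_hubAt_eq_angUnit _ _ δs ε η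
  have hambt : ∀ η (y : GnoFol L), ⟪At η y, y⟫_ℝ =
      iteratedFDeriv ℝ 2 (gnoDeficit (fun _ => false) (fun _ => 1) (angUnit (Real.pi / 2 - Real.arctan δt)) ε) η (fun _ => gnoFolEmb y) :=
    fun η y => by rw [← eθt]; exact hAtamb η y
  have hambs : ∀ η (y : GnoFol L), ⟪As η y, y⟫_ℝ =
      iteratedFDeriv ℝ 2 (gnoDeficit (fun _ => false) (fun _ => 1) (angUnit (Real.pi / 2 - Real.arctan δs)) ε) η (fun _ => gnoFolEmb y) :=
    fun η y => by rw [← eθs]; exact hAsamb η y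
  have hθθ : |(Real.pi / 2 - Real.arctan δs) - (Real.pi / 2 - Real.arctan δt)| ≤ δr⁻¹ := abs_hubAngle_sub_le_inv hδr0 hrs hrt
  have hηη : ‖η₀' - η₀‖ = ‖(gnoBase p.1 p.2 : GnoCoord L) - gnoBase p'.1 p'.2‖ := by rw [hη₀, hη₀', norm_sub_rev]
  have hwin' : (122689728 * |(Real.pi / 2 - Real.arctan δs) - (Real.pi / 2 - Real.arctan δt)| + 44712000 * ‖η₀' - η₀‖) * (L : ℝ) ^ 4 ≤ μ / (2 * (3 * N)) := by
    rw [hηη]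
    exact le_trans (by gcongr) hwin
  have hN6 : 1 ≤ 2 * (3 * N) := by linarith
  have hnear : (122689728 * |(Real.pi / 2 - Real.arctan δs) - (Real.pi / 2 - Real.arctan δt)| + 44712000 * ‖η₀' - η₀‖) * (L : ℝ) ^ 4 ≤ μ / 2 := by
    refine hwin'.trans ?_
    rw [div_le_div_iff₀ (by positivity) (by norm_num)]
    nlinarith
  have hlog := abs_log_det_gnoFolHessian_sub_le_joint (fun _ => false) (fun _ => (1 : SU2)) hsins.le hsint.le ε hAss hAts hambs hambt hμ0
    (gnoFolHessian_coercive_base (hubAt_one_ne_zero δt) ε hε.1 hε.2 p.1 p.2 hAtray) hnear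
  have hlog1 : Real.log (LinearMap.det (As η₀')) ≤ Real.log (LinearMap.det (At η₀)) + 1 := by
    have h1 : 2 * (3 * N) * ((122689728 * |(Real.pi / 2 - Real.arctan δs) - (Real.pi / 2 - Real.arctan δt)| + 44712000 * ‖η₀' - η₀‖) * (L : ℝ) ^ 4) / μ ≤ 1 := by
      rw [div_le_one hμ0]
      calc 2 * (3 * N) * ((122689728 * |(Real.pi / 2 - Real.arctan δs) - (Real.pi / 2 - Real.arctan δt)| + 44712000 * ‖η₀' - η₀‖) * (L : ℝ) ^ 4)
          ≤ 2 * (3 * N) * (μ / (2 * (3 * N))) := by gcongr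
        _ = μ := by field_simp
    have h2 := (abs_sub_le_iff.1 hlog).1
    linarith
  have hM : Ds ≤ Real.exp (1 / 2) * Dt := by
    have h1 : LinearMap.det (As η₀') ≤ Real.exp 1 * LinearMap.det (At η₀) := by
      rw [← Real.exp_log hdets0, ← Real.exp_log hdett0, ← Real.exp_add, add_comm]
      exact Real.exp_le_exp.2 hlog1
    have h2 : Real.exp 1 = Real.exp (1 / 2) ^ 2 := by rw [← Real.exp_nat_mul]; norm_num
    calc Ds = Real.sqrt (LinearMap.det (As η₀')) := hDs
      _ ≤ Real.sqrt (Real.exp 1 * LinearMap.det (At η₀)) := Real.sqrt_le_sqrt h1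
      _ = Real.exp (1 / 2) * Dt := by rw [Real.sqrt_mul (Real.exp_pos _).le, h2, Real.sqrt_sq (Real.exp_pos _).le, hDt]
  -- §D the structured floor kept whole: `1/det M′ ≤ 2K²(1+δt²)²/(1 + h(p)(1+δt²))`
  have hD := floorDetRescaled_ge_profile (L := L) (Real.pi / 2 - Real.arctan δt) p
  set D : ℝ := ((1 / 4 : ℝ) * (16 * Real.cos (Real.pi / 2 - Real.arctan δt) ^ 2 * Real.sin (Real.pi / 2 - Real.arctan δt) ^ 2 /
          ((7200 * (L : ℝ) ^ 6) * (1 + p.1 ^ 2))) * Real.sqrt (1 + p.1 ^ 2) ^ 2) *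
        ((1 / 4 : ℝ) * (4 * Real.sin (Real.pi / 2 - Real.arctan δt) ^ 2 / ((1800 * (L : ℝ) ^ 6) * (1 + p.2 ^ 2))) * Real.sqrt (1 + p.2 ^ 2) ^ 2) +
      ((1 / 4 : ℝ) * (4 / ((1800 * (L : ℝ) ^ 6) * ((1 + p.1 ^ 2) * (1 + p.2 ^ 2))))) *
        (((1 / 4 : ℝ) * (16 * Real.cos (Real.pi / 2 - Real.arctan δt) ^ 2 * Real.sin (Real.pi / 2 - Real.arctan δt) ^ 2 /
            ((7200 * (L : ℝ) ^ 6) * (1 + p.1 ^ 2))) * Real.sqrt (1 + p.1 ^ 2) ^ 2) * (p.1 * Real.sqrt (1 + p.2 ^ 2)) ^ 2 +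
          ((1 / 4 : ℝ) * (4 * Real.sin (Real.pi / 2 - Real.arctan δt) ^ 2 / ((1800 * (L : ℝ) ^ 6) * (1 + p.2 ^ 2))) * Real.sqrt (1 + p.2 ^ 2) ^ 2) *
            (Real.sqrt (1 + p.1 ^ 2) * p.2) ^ 2) with hDdef
  have hcs : Real.cos (Real.pi / 2 - Real.arctan δt) ^ 2 * Real.sin (Real.pi / 2 - Real.arctan δt) ^ 2 = δt ^ 2 / (1 + δt ^ 2) ^ 2 := by
    rw [hct2, hst2]; field_simp
  rw [hcs, hst2, ← hH] at hD
  set K2 : ℝ := (1800 * (L : ℝ) ^ 6) ^ 2 with hK2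
  have hK20 : 0 < K2 := by rw [hK2]; positivity
  have hB0 : 0 < 1 + H * (1 + δt ^ 2) := by positivity
  have hD0 : 0 < D := lt_of_lt_of_le (by positivity) hD
  have hprof : 1 / D ≤ 2 * K2 * (1 + δt ^ 2) ^ 2 / (1 + H * (1 + δt ^ 2)) := by
    rw [div_le_div_iff₀ hD0 hB0, one_mul]
    have hD' := (div_le_iff₀ hK20).1 hD
    have e1 : 2 * (1 + δt ^ 2) ^ 2 * (δt ^ 2 / (1 + δt ^ 2) ^ 2 * (1 / (1 + δt ^ 2) + H)) = 2 * δt ^ 2 / (1 + δt ^ 2) + 2 * δt ^ 2 * H := by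
      field_simp
    have hx : 1 ≤ δt ^ 2 := by nlinarith
    have h3 : 1 ≤ 2 * δt ^ 2 / (1 + δt ^ 2) := by rw [le_div_iff₀ (by positivity)]; linarith
    have h4 : H * (1 + δt ^ 2) ≤ 2 * δt ^ 2 * H := by nlinarith
    calc 1 + H * (1 + δt ^ 2) ≤ 2 * δt ^ 2 / (1 + δt ^ 2) + 2 * δt ^ 2 * H := by linarith
      _ = 2 * (1 + δt ^ 2) ^ 2 * (δt ^ 2 / (1 + δt ^ 2) ^ 2 * (1 / (1 + δt ^ 2) + H)) := e1.symm
      _ ≤ 2 * (1 + δt ^ 2) ^ 2 * (D * K2) := mul_le_mul_of_nonneg_left hD' (by positivity)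
      _ = 2 * K2 * (1 + δt ^ 2) ^ 2 * D := by ring
  -- §A assembly
  set Z : ℝ := Real.sqrt ((1 / 4 : ℝ) * (1 / (1800 * (L : ℝ) ^ 6))) ^ 3 with hZ
  have hZ0 : 0 < Z := by rw [hZ]; positivity
  set ρb : ℝ := gnoDensity (gnoBase p.1 p.2 : GnoCoord L) with hρb
  have hρb0 : 0 < ρb := gnoDensity_pos _
  have hJac : ρb * ((1 + p.1 ^ 2) * (1 + p.2 ^ 2)) = (1 + p.1 ^ 2)⁻¹ * (1 + p.2 ^ 2)⁻¹ := by rw [hρb]; exact gnoDensity_gnoBase_mul_jacobian p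
  set w : ℝ := (1 + p.1 ^ 2)⁻¹ * (1 + p.2 ^ 2)⁻¹ with hw
  set w' : ℝ := (1 + p'.1 ^ 2)⁻¹ * (1 + p'.2 ^ 2)⁻¹ with hw'
  have hw0 : 0 < w := by rw [hw]; positivity
  have hw'0 : 0 < w' := by rw [hw']; positivity
  set C7 : ℝ := ((1 + d) * (20400 * (L : ℝ) ^ 4)) ^ (-(7 / 2 : ℝ)) with hC7
  have hC70 : 0 < C7 := by rw [hC7]; exact Real.rpow_pos_of_pos (by positivity) _
  have hC7inv : C7⁻¹ = ((1 + d) * (20400 * (L : ℝ) ^ 4)) ^ (7 / 2 : ℝ) := by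
    rw [hC7, Real.rpow_neg (by positivity), inv_inv]
  have hexp : Real.exp (-(1 / 2 : ℝ)) = (Real.exp (1 / 2))⁻¹ := by rw [Real.exp_neg]
  -- (S): `w′ ≤ ms · Ds · e^{1/2}/C7`
  have hS' : w' * (C7 * Real.exp (-(1 / 2 : ℝ)) / Ds) ≤ mbDensity (L := L) (hubAt δs 1) ε p' := hS
  have hms0 : 0 ≤ mbDensity (L := L) (hubAt δs 1) ε p' := le_trans (by positivity) hS'
  have hw'le : w' ≤ mbDensity (L := L) (hubAt δs 1) ε p' * (Ds * Real.exp (1 / 2) / C7) := by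
    have e : w' * (C7 * Real.exp (-(1 / 2 : ℝ)) / Ds) * (Ds * Real.exp (1 / 2) / C7) = w' := by
      rw [hexp]; field_simp
    rw [← e]
    exact mul_le_mul_of_nonneg_right hS' (by positivity)
  -- (T): `mt ≤ w/(Z D Dt)`
  have hT' : mbDensity (L := L) (hubAt δt 1) ε p ≤ w / (Z * D * Dt) := by rw [← hJac]; exact hT
  have hDsDt : Ds / Dt ≤ Real.exp (1 / 2) := (div_le_iff₀ hDt0).2 hM
  calc mbDensity (L := L) (hubAt δt 1) ε p ≤ w / (Z * D * Dt) := hT'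
    _ = w * (1 / D) / (Z * Dt) := by field_simp
    _ ≤ w * (2 * K2 * (1 + δt ^ 2) ^ 2 / (1 + H * (1 + δt ^ 2))) / (Z * Dt) := by gcongr
    _ = (w / w') * (2 * K2 * (1 + δt ^ 2) ^ 2 / (1 + H * (1 + δt ^ 2))) / Z * (w' / Dt) := by field_simp
    _ ≤ (w / w') * (2 * K2 * (1 + δt ^ 2) ^ 2 / (1 + H * (1 + δt ^ 2))) / Z * (mbDensity (L := L) (hubAt δs 1) ε p' * (Ds * Real.exp (1 / 2) / C7) / Dt) := by
        gcongr
    _ = (w / w') * (2 * K2 * (1 + δt ^ 2) ^ 2 / (1 + H * (1 + δt ^ 2))) / Z * (mbDensity (L := L) (hubAt δs 1) ε p' * Real.exp (1 / 2) / C7 * (Ds / Dt)) := by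
        field_simp
    _ ≤ (w / w') * (2 * K2 * (1 + δt ^ 2) ^ 2 / (1 + H * (1 + δt ^ 2))) / Z * (mbDensity (L := L) (hubAt δs 1) ε p' * Real.exp (1 / 2) / C7 * Real.exp (1 / 2)) := by
        gcongr
    _ = (Real.exp (1 / 2) * Real.exp (1 / 2) * C7⁻¹ * Z⁻¹ * (2 * K2)) * ((1 + δt ^ 2) ^ 2 / (1 + H * (1 + δt ^ 2))) * (w / w') *
          mbDensity (L := L) (hubAt δs 1) ε p' := by
        field_simp
    _ = _ := by
        rw [← Real.exp_add, show (1 / 2 : ℝ) + 1 / 2 = 1 by norm_num, hC7inv, hZ, hK2, hw, hw', hH]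
        congr 1
        congr 1
        field_simp

end Summit.QuantumFields.YangMills.Theorems.SwapVirialDeficit.SectorLaplace

end
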